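import Summits.CriticalPhenomena.PercolationContinuityZ3.Theorems.PercNearOneGluingNoHeavyQuantBlockCombLightMerge
import HarnessLib

/-!
# QUANT lane R8, FAR on trees: the light-merge row at EVERY DEPTH, and several root blocks of DIFFERENT gates over a reliable comb
# (the (β) family of LEAD-NOTES-G12 N23 (2g); canonical block-comb model)

builds on p205010 (kernel theorem, internal audit signed; external expert review pending)

Support file (`--supports stmt-CriticalPhenomena-4575`), QUANT lane seat prim-quant-p1 (gen 9); memo
`run/shared/lean/prim/quant/P1-SURPLUS.md` §20.  Theorems only (local notation, no definitions), no sorries, standard axioms.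
Model and notation: `…QuantBlockCombMergeModel.lean`; tools: the `D = 1` light-merge row `Quant.BlockComb.tail_one_ge_rootGate_of_lightMerge`
(`…QuantBlockCombLightMerge.lean`, same seat), the root split `Quant.BlockComb.tail_succ_ge_rootGate_mul` and `sum_marg_le_contracted`
(lead g13, `…QuantBlockCombTwoPlateauRoot.lean`).

Call a blob LIGHT when its private gate is below the LAST chain gate `q D` (given that its level is reached it is less reliable than the
terminal block is given that the last plateau is reached) and RELIABLE otherwise (`g k ≥ q D`; the sure terminal-level blobs are reliable).

* `Quant.BlockComb.tail_ge_of_lightMerge` — **THE LIGHT-MERGE ROW, EVERY DEPTH.**  Chain `q 0, …, q D`, terminal-level blobs sure, `j ≥ 1`,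
  the mean hypothesis `2j < Σ_k a k·marginal k` (`= EN`), and every live light blob `s` (any level) has `j ≤ g s·(reliable mass)`; then
  `∏_{i ≤ D} q i ≤ TAIL[D+1]`.  Proof: `D` root splits (they keep every private gate, hence the light/reliable partition and the merge
  hypothesis, and only raise the mean) down to the `D = 1` row.  CONTAINS `tail_ge_of_gates_ge_lastGate` (no light blob: the merge
  hypothesis is void) and `tail_two_ge_of_commonRoot` (lead g13; below).
* `Quant.BlockComb.tail_ge_of_lightRoots` — **COROLLARY (several root blocks of DIFFERENT gates over a reliable comb; the (β) family of
  LEAD-NOTES-G12 N23 (2g) / LEAD-NOTES-G13 N24 (2) 'limit', every depth).**  Chain of `D+1` gates, `x = ∏ q`; live root blobs with arbitrary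
  gates `≥ x` and root MEAN `Σ_{lv k = 0} a k·g k ≤ j` (e.g. root mass `≤ j`); every deeper non-terminal live blob reliable (`g k ≥ q D`: tied
  OR more reliable); terminal level sure; budget `2j < Σ_{lv k = 0} a k·g k + x·Σ_{lv k ≠ 0} a k` (the mean with the deep part counted AT
  THE FLOOR `x`; `= EN` when the deep blobs are tied).  Then `x ≤ TAIL`, every layer `j`.  The merge hypothesis holds because the budget
  leaves `x·(deep mass) > j` and every root gate is `≥ x`.
* `Quant.BlockComb.tail_two_ge_of_roots` — the two-plateau instance in the shape of `tail_two_ge_of_commonRoot` (lead g13): the common root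
  gate `ρ` is replaced by ARBITRARY root gates `≥ x`, 'root size `≤ j`' by 'root mean `≤ j`', 'tied middle level' by 'middle gates `≥ q 1`'
  (budgeted at the floor) — the (β) family over a tied plateau is settled, both regimes of N24 (2) at once and with no interior minimum
  located.
Honest scope: light blobs that cannot see `j` reliable relays are not covered (LEAD-NOTES-G13 N24 (4)); an untied middle blob that is less
reliable than the last chain gate counts as light; reliable-but-untied middle blobs enter the corollaries' budget only at the floor `x`.
-/

namespace Summit.CriticalPhenomena.PercolationContinuityZ3.Theorems

namespace Quant

namespace BlockComb

open Finset

variable {κ : Type*} [Fintype κ] [DecidableEq κ]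

/-- product-Bernoulli weight of the set `S` of open blob gates -/
local notation3 "wt[" g ", " S "]" => ∏ k, (if k ∈ (S : Finset κ) then (g : κ → ℝ) k else 1 - (g : κ → ℝ) k)

/-- the same weight with the gate of `s` removed -/
local notation3 "wt'[" g ", " s ", " S "]" =>
  ∏ k ∈ (Finset.univ : Finset κ).erase s, (if k ∈ (S : Finset κ) then (g : κ → ℝ) k else 1 - (g : κ → ℝ) k)

/-- probability that the chain `q` of length `D` is open exactly to depth `i` -/
local notation3 "pd[" D ", " q ", " i "]" =>
  (∏ i' ∈ Finset.range (i : ℕ), (q : ℕ → ℝ) i') * (if (i : ℕ) < (D : ℕ) then 1 - (q : ℕ → ℝ) i else 1)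

/-- mass counted at depth `i` in blob configuration `S` -/
local notation3 "mass[" lv ", " a ", " i ", " S "]" =>
  ∑ k ∈ (S : Finset κ).filter (fun k => (lv : κ → ℕ) k ≤ (i : ℕ)), ((a : κ → ℕ) k : ℕ)

/-- the tail `P(N ≥ j+1)` of the block-comb count, as an explicit finite sum -/
local notation3 "TAIL[" D ", " q ", " lv ", " a ", " g ", " j "]" =>
  ∑ i ∈ Finset.range ((D : ℕ) + 1), pd[D, q, i] *
    ∑ S : Finset κ, wt[g, S] * (if (j : ℕ) + 1 ≤ mass[lv, a, i, S] then (1 : ℝ) else 0)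

/-! ### 3. Every depth, by root splits -/

/-- **THEOREM (the light-merge row, every depth, canonical model).**  Chain gates `q 0, …, q D ∈ [0,1]`, blobs with levels `≤ D+1` and
private gates in `[0,1]`, terminal-level blobs (level `D+1`) sure, a layer `j ≥ 1`, the mean hypothesis `2j < Σ_k a k·(∏_{i<lv k} q i)·g k`
(`= EN`), and the merge hypothesis: every live light blob `s` (`g s < q D`, the LAST chain gate; any level) satisfies
`j ≤ g s·Σ_{g k ≥ q D} a k`.  Then `∏_{i ≤ D} q i ≤ TAIL[D+1, q, lv, a, g, j]` — FAR with `x` = the terminal marginal.  Proof: induction on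
`D` by the root split `tail_succ_ge_rootGate_mul` (private gates, the light/reliable partition and the merge hypothesis are unchanged, the
mean only grows: `sum_marg_le_contracted`); base = `tail_one_ge_rootGate_of_lightMerge`.  Contains `tail_ge_of_gates_ge_lastGate`. [this work] -/
theorem tail_ge_of_lightMerge : ∀ (D : ℕ) (q : ℕ → ℝ), (∀ i, 0 ≤ q i ∧ q i ≤ 1) →
    ∀ (lv : κ → ℕ), (∀ k, lv k ≤ D + 1) → ∀ (a : κ → ℕ) (g : κ → ℝ), (∀ k, 0 ≤ g k ∧ g k ≤ 1) → ∀ (j : ℕ), 0 < j →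
    (∀ k, lv k = D + 1 → g k = 1) →
    (2 * j : ℝ) < ∑ k, (a k : ℝ) * ((∏ i ∈ Finset.range (lv k), q i) * g k) →
    (∀ s, 0 < a s → g s < q D → (j : ℝ) ≤ g s * ∑ k ∈ Finset.univ.filter (fun k => q D ≤ g k), (a k : ℝ)) →
    ∏ i ∈ Finset.range (D + 1), q i ≤ TAIL[D + 1, q, lv, a, g, j] := by
  intro D
  induction D with
  | zero =>
    intro q hq lv hlv a g hg j hj hsure hbudget hlight
    rw [Finset.prod_range_one]
    refine tail_one_ge_rootGate_of_lightMerge q hq lv (fun k => by have := hlv k; omega) a g hg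
      (fun k hk => hsure k (by have := hlv k; omega)) j hj ?_ hlight
    -- the mean in filter form
    have hsplit : ∑ k, (a k : ℝ) * ((∏ i ∈ Finset.range (lv k), q i) * g k) =
        ∑ k ∈ Finset.univ.filter (fun k => lv k = 0), (a k : ℝ) * g k +
          q 0 * ∑ k ∈ Finset.univ.filter (fun k => lv k ≠ 0), (a k : ℝ) := by
      rw [Finset.sum_filter, Finset.sum_filter, Finset.mul_sum, ← Finset.sum_add_distrib]
      refine Finset.sum_congr rfl fun k _ => ?_
      by_cases hk : lv k = 0
      · rw [if_pos hk, if_neg (not_not.2 hk), hk, Finset.prod_range_zero, one_mul, mul_zero, add_zero]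
      · have h1 : lv k = 1 := by have := hlv k; omega
        rw [if_neg hk, if_pos hk, h1, Finset.prod_range_one, hsure k h1]; ring
    rw [← hsplit]; exact hbudget
  | succ D ih =>
    intro q hq lv hlv a g hg j hj hsure hbudget hlight
    have hq' : ∀ i, 0 ≤ q (i + 1) ∧ q (i + 1) ≤ 1 := fun i => hq (i + 1)
    have hih := ih (fun i => q (i + 1)) hq' (fun k => lv k - 1) (fun k => by have := hlv k; omega) a g hg j hj
      (fun k hk => hsure k (by have := hlv k; omega))
      (hbudget.trans_le (sum_marg_le_contracted q hq lv a g hg)) hlight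
    calc ∏ i ∈ Finset.range (D + 1 + 1), q i = q 0 * ∏ i ∈ Finset.range (D + 1), q (i + 1) := prefixProd_succ q (D + 1)
      _ ≤ q 0 * TAIL[D + 1, (fun i => q (i + 1)), (fun k => lv k - 1), a, g, j] := mul_le_mul_of_nonneg_left hih (hq 0).1
      _ ≤ TAIL[D + 1 + 1, q, lv, a, g, j] := tail_succ_ge_rootGate_mul (D + 1) q hq lv a g hg j

/-! ### 4. Several root blocks of different gates over a reliable comb -/

/-- **COROLLARY (light root block-star over a reliable comb; the (β) family at every depth).**  Chain gates `q 0, …, q D ∈ [0,1]`,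
`x := ∏_{i ≤ D} q i`; levels `≤ D+1`; live ROOT blobs with arbitrary private gates `≥ x` and root MEAN `Σ_{lv k = 0} a k·g k ≤ j` (e.g.
root mass `≤ j`); every live blob at levels `1 … D` reliable (`g k ≥ q D`: tied to the terminal or more reliable); terminal level `D+1` sure;
budget `2j < Σ_{lv k = 0} a k·g k + x·Σ_{lv k ≠ 0} a k` (the mean with the deep part counted at the floor `x`; `= EN` when the deep blobs are
tied).  Then `x ≤ TAIL[D+1] = P(N ≥ j+1)`, for every layer `j`.  Proof: `j ≥ 1` — the light blobs are root blobs, each of gate `≥ x`, and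
the budget leaves `x·(deep mass) > 2j − j`, so `tail_ge_of_lightMerge` applies; `j = 0` — a live blob has marginal `≥ x`. [this work] -/
theorem tail_ge_of_lightRoots (D : ℕ) (q : ℕ → ℝ) (hq : ∀ i, 0 ≤ q i ∧ q i ≤ 1) (lv : κ → ℕ) (hlv : ∀ k, lv k ≤ D + 1)
    (a : κ → ℕ) (g : κ → ℝ) (hg : ∀ k, 0 ≤ g k ∧ g k ≤ 1) (j : ℕ)
    (hroot : ∀ k, 0 < a k → lv k = 0 → ∏ i ∈ Finset.range (D + 1), q i ≤ g k)
    (hdeep : ∀ k, 0 < a k → 1 ≤ lv k → lv k ≤ D → q D ≤ g k)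
    (hsure : ∀ k, lv k = D + 1 → g k = 1)
    (hrootMean : ∑ k ∈ Finset.univ.filter (fun k => lv k = 0), (a k : ℝ) * g k ≤ j)
    (hbudget : (2 * j : ℝ) < ∑ k ∈ Finset.univ.filter (fun k => lv k = 0), (a k : ℝ) * g k +
      (∏ i ∈ Finset.range (D + 1), q i) * ∑ k ∈ Finset.univ.filter (fun k => lv k ≠ 0), (a k : ℝ)) :
    ∏ i ∈ Finset.range (D + 1), q i ≤ TAIL[D + 1, q, lv, a, g, j] := by
  set x : ℝ := ∏ i ∈ Finset.range (D + 1), q i with hxdef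
  have hx01 : 0 ≤ x ∧ x ≤ 1 := prefixProd_mem q hq (D + 1)
  have hxD : x ≤ q D := by
    rw [hxdef, Finset.prod_range_succ]
    have h1 : (∏ i ∈ Finset.range D, q i) ≤ 1 := (prefixProd_mem q hq D).2
    have := mul_le_mul_of_nonneg_right h1 (hq D).1
    linarith
  -- every live marginal is at least `x`
  have hmarg : ∀ k, 0 < a k → x ≤ (∏ i ∈ Finset.range (lv k), q i) * g k := by
    intro k hk
    by_cases hk0 : lv k = 0
    · rw [hk0, Finset.prod_range_zero, one_mul]; exact hroot k hk hk0
    · by_cases hkD : lv k = D + 1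
      · rw [hkD, hsure k hkD, mul_one]
      · have h1 : 1 ≤ lv k := Nat.one_le_iff_ne_zero.2 hk0
        have h2 : lv k ≤ D := by have := hlv k; omega
        calc x = (∏ i ∈ Finset.range D, q i) * q D := by rw [hxdef, Finset.prod_range_succ]
          _ ≤ (∏ i ∈ Finset.range (lv k), q i) * q D :=
              mul_le_mul_of_nonneg_right (prefixProd_antitone q hq h2) (hq D).1
          _ ≤ (∏ i ∈ Finset.range (lv k), q i) * g k :=
              mul_le_mul_of_nonneg_left (hdeep k hk h1 h2) (prefixProd_mem q hq (lv k)).1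
  rcases Nat.eq_zero_or_pos j with hj | hj
  · -- layer `0`: a live blob (the budget is positive) is a giant
    subst hj
    have hlive : ∃ k, 0 < a k := by
      by_contra hnone
      push Not at hnone
      have hz : ∀ k, a k = 0 := fun k => Nat.le_zero.1 (hnone k)
      have h1 : ∑ k ∈ Finset.univ.filter (fun k => lv k = 0), (a k : ℝ) * g k = 0 :=
        Finset.sum_eq_zero fun k _ => by rw [hz k]; simp
      have h2 : ∑ k ∈ Finset.univ.filter (fun k => lv k ≠ 0), (a k : ℝ) = 0 :=
        Finset.sum_eq_zero fun k _ => by rw [hz k]; simp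
      rw [h1, h2, mul_zero, add_zero] at hbudget
      norm_num at hbudget
    obtain ⟨k, hk⟩ := hlive
    exact (hmarg k hk).trans (tail_ge_marg_of_giant (D + 1) q hq lv a g hg 0 k (by omega) (hlv k))
  · -- layer `j ≥ 1`: the light-merge row
    refine tail_ge_of_lightMerge D q hq lv hlv a g hg j hj hsure ?_ ?_
    · -- the mean dominates the floor budget
      refine hbudget.trans_le ?_
      rw [Finset.sum_filter, Finset.sum_filter, Finset.mul_sum, ← Finset.sum_add_distrib]
      refine Finset.sum_le_sum fun k _ => ?_
      by_cases hk : lv k = 0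
      · rw [if_pos hk, if_neg (not_not.2 hk), mul_zero, add_zero, hk, Finset.prod_range_zero, one_mul]
      · rw [if_neg hk, if_pos hk, zero_add]
        by_cases hak : 0 < a k
        · rw [mul_comm x]
          exact mul_le_mul_of_nonneg_left (hmarg k hak) (Nat.cast_nonneg _)
        · have : a k = 0 := by omega
          rw [this]; simp
    · -- the merge hypothesis: a live light blob is a root blob of gate `≥ x`, and `x·(deep mass) > j`
      intro s hs hslt
      have hs0 : lv s = 0 := by
        by_contra h0
        by_cases hsD : lv s = D + 1
        · rw [hsure s hsD] at hslt; exact absurd hslt (not_lt.2 (hq D).2)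
        · have h1 : 1 ≤ lv s := Nat.one_le_iff_ne_zero.2 h0
          have h2 : lv s ≤ D := by have := hlv s; omega
          exact absurd hslt (not_lt.2 (hdeep s hs h1 h2))
      have hgs : x ≤ g s := hroot s hs hs0
      -- every blob below the root is reliable, so the reliable mass contains the deep mass
      have hdeepRel : ∑ k ∈ Finset.univ.filter (fun k => lv k ≠ 0), (a k : ℝ) ≤
          ∑ k ∈ Finset.univ.filter (fun k => q D ≤ g k), (a k : ℝ) := by
        rw [Finset.sum_filter, Finset.sum_filter]
        refine Finset.sum_le_sum fun k _ => ?_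
        by_cases hk : lv k ≠ 0
        · rw [if_pos hk]
          by_cases hak : 0 < a k
          · have hrel : q D ≤ g k := by
              by_cases hkD : lv k = D + 1
              · rw [hsure k hkD]; exact (hq D).2
              · exact hdeep k hak (Nat.one_le_iff_ne_zero.2 hk) (by have := hlv k; omega)
            rw [if_pos hrel]
          · have : a k = 0 := by omega
            rw [this]; split_ifs <;> simp
        · rw [if_neg hk]; split_ifs <;> positivity
      have hdeepnn : 0 ≤ ∑ k ∈ Finset.univ.filter (fun k => lv k ≠ 0), (a k : ℝ) :=
        Finset.sum_nonneg fun k _ => Nat.cast_nonneg _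
      have h1 : (j : ℝ) < x * ∑ k ∈ Finset.univ.filter (fun k => lv k ≠ 0), (a k : ℝ) := by linarith
      calc (j : ℝ) ≤ x * ∑ k ∈ Finset.univ.filter (fun k => lv k ≠ 0), (a k : ℝ) := h1.le
        _ ≤ g s * ∑ k ∈ Finset.univ.filter (fun k => lv k ≠ 0), (a k : ℝ) := mul_le_mul_of_nonneg_right hgs hdeepnn
        _ ≤ g s * ∑ k ∈ Finset.univ.filter (fun k => q D ≤ g k), (a k : ℝ) := mul_le_mul_of_nonneg_left hdeepRel (hg s).1

/-- **COROLLARY (every two-plateau block-comb with a light root block-star, canonical model).**  Chain gates `q 0, q 1 ∈ [0,1]`,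
`x := q 0·q 1`; levels `≤ 2`; live root blobs (level `0`) with ARBITRARY gates `≥ x` and root mean `Σ_{lv = 0} a·g ≤ j`; live level-`1` blobs
with gates `≥ q 1` (tied at `x` or more reliable); level-`2` blobs sure (the terminal block); budget `2j < Σ_{lv = 0} a·g + x·Σ_{lv ≠ 0} a`.
Then `x ≤ TAIL[2, q, lv, a, g, j] = P(N ≥ j+1)`.  This is `tail_two_ge_of_commonRoot` (lead g13) with the common root gate `ρ` replaced by
arbitrary root gates and 'root size `≤ j`' by 'root mean `≤ j`': in gate coordinates (LEAD-NOTES-G10 N21 (0)) several root blocks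
`(r_k, ρ_k ≥ x)` with `Σ r_k ρ_k ≤ j`, any number of blobs `(b_i, h_i ≥ x/w)` at ONE height `w`, terminal `c` at `x`, and
`Σ r_k ρ_k + x·(Σ b_i + c) > 2j` ⟹ FAR — the (β) family of LEAD-NOTES-G12 N23 (2g) over a tied plateau, both regimes at once. [this work] -/
theorem tail_two_ge_of_roots (q : ℕ → ℝ) (hq : ∀ i, 0 ≤ q i ∧ q i ≤ 1) (lv : κ → ℕ) (hlv : ∀ k, lv k ≤ 2)
    (a : κ → ℕ) (g : κ → ℝ) (hg : ∀ k, 0 ≤ g k ∧ g k ≤ 1) (j : ℕ)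
    (hroot : ∀ k, 0 < a k → lv k = 0 → q 0 * q 1 ≤ g k)
    (hmid : ∀ k, 0 < a k → lv k = 1 → q 1 ≤ g k) (hterm : ∀ k, lv k = 2 → g k = 1)
    (hrootMean : ∑ k ∈ Finset.univ.filter (fun k => lv k = 0), (a k : ℝ) * g k ≤ j)
    (hbudget : (2 * j : ℝ) < ∑ k ∈ Finset.univ.filter (fun k => lv k = 0), (a k : ℝ) * g k +
      (q 0 * q 1) * ∑ k ∈ Finset.univ.filter (fun k => lv k ≠ 0), (a k : ℝ)) :
    q 0 * q 1 ≤ TAIL[1 + 1, q, lv, a, g, j] := by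
  have h := tail_ge_of_lightRoots 1 q hq lv hlv a g hg j
    (fun k hk hk0 => by rw [prefixProd_two]; exact hroot k hk hk0)
    (fun k hk h1 h1' => hmid k hk (le_antisymm h1' h1)) hterm hrootMean (by rw [prefixProd_two]; exact hbudget)
  rwa [prefixProd_two] at h

end BlockComb

end Quant

end Summit.CriticalPhenomena.PercolationContinuityZ3.Theorems
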